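import Mathlib
import Literature.Analysis.FluidPDE.TaoCascadeODE
import HarnessLib

/-!
# `PicardRadiiRungThree.RadiiGlueR` (item stmt-NavierStokesRegularity-23947) — from a Picard path in
  the ω-scaled window space to an exact window trajectory of the truncated cascade

Route `PicardRadiiRungThree` (rung TL-M3 of the Tao ladder; MODEL lattice ODEs only — Tao 2016, §4
(4.8), cell vocabulary `TaoCascade.quadTerm`). The window states are `E = Fin 4 → ↥[−Kb, Ka] → ℝ`
(sup norm), embedded into families on `ℤ` by zero (`fE`) and rescaled shellwise by weights `ω_k > 0`;
the ω-scaled truncated field is `Q(e)_{i,k} = quadTerm(ω·fE e)_{i,k}/ω_k`. If the extended path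
`P̃ = IccExtend P` of `P : C([0,1], E)` has derivative `T • Q(P̃(t))` within `[0,1]` (`T > 0`: the
physical horizon), then the unscaled window trajectory `x_{i,n}(s) = ω_n · fE(P̃(s/T))_{i,n}` solves
the window-truncated cascade ODE `ẋ_{i,k} = quadTerm(x · 𝟙_{window})_{i,k}` within `[0, S]` for every
`S ≤ T` (`flow_hasDerivWithinAt`; time rescaling and componentwise derivatives). Also: the
quadratic term only depends on the family at the evaluation time (`quadTerm_congr`), and `Q` is
continuous (`continuous_scaledField`).

HONEST FRAMING: bookkeeping about Tao-type MODEL lattice ODEs; nothing here is a statement about the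
Navier–Stokes equations; NS regularity is NOT proved by anything in this file.
-/

noncomputable section

-- the sub-problem namespace repeats the summit name by design (D-0017)
set_option linter.dupNamespace false

namespace Summit.NavierStokesRegularity.NavierStokesRegularity.Theorems

open Set Literature.Analysis.FluidPDE Literature.Analysis.FluidPDE.TaoCascade

namespace RadiiGlueR

/-- The quadratic term at time `t` only depends on the values of the family at time `t`.
[cite: Tao2016AveragedNS, §4 (4.8)] -/
theorem quadTerm_congr {ε₀ : ℝ} {m : ℕ} (α : Fin m → Fin m → Fin m → ℤ × ℤ × ℤ → ℝ)
    {X X' : Fin m → ℤ → ℝ → ℝ} {t t' : ℝ} (h : ∀ j n, X j n t = X' j n t') (i : Fin m) (n : ℤ) :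
    quadTerm ε₀ α X i n t = quadTerm ε₀ α X' i n t' := by
  unfold quadTerm
  simp only [h]

variable {Kb Ka : ℤ}

/-- **The ω-scaled truncated cascade field is continuous** on the window space (a polynomial in the
finitely many coordinates). [cite: Tao2016AveragedNS, §4 (4.8)] -/
theorem continuous_scaledField (α : Fin 4 → Fin 4 → Fin 4 → ℤ × ℤ × ℤ → ℝ) (ω : ℤ → ℝ)
    (fE : (Fin 4 → ↥(Finset.Icc (-Kb) Ka) → ℝ) → Fin 4 → ℤ → ℝ)
    (hfEc : ∀ i n, Continuous fun e => fE e i n)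
    (Q : (Fin 4 → ↥(Finset.Icc (-Kb) Ka) → ℝ) → (Fin 4 → ↥(Finset.Icc (-Kb) Ka) → ℝ))
    (hQ : ∀ e i (k : ↥(Finset.Icc (-Kb) Ka)),
      Q e i k = quadTerm 1 α (fun j' n (_ : ℝ) => ω n * fE e j' n) i k 0 / ω k) :
    Continuous Q := by
  refine continuous_pi fun i => continuous_pi fun k => ?_
  have heq : (fun e => Q e i k) =
      fun e => quadTerm 1 α (fun j' n (_ : ℝ) => ω n * fE e j' n) i k 0 / ω k := funext fun e => hQ e i k
  rw [heq]
  refine Continuous.div_const ?_ _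
  unfold quadTerm
  refine continuous_finsetSum _ fun i₁ _ => continuous_finsetSum _ fun i₂ _ =>
    continuous_finsetSum _ fun μ _ => ?_
  exact ((continuous_const.mul ((continuous_const.mul (hfEc _ _)).mul
    (continuous_const.mul (hfEc _ _)))))

/-- The zero-extension of window states is continuous in the state, coordinatewise. [folklore] -/
theorem continuous_fE (i : Fin 4) (n : ℤ) :
    Continuous fun e : Fin 4 → ↥(Finset.Icc (-Kb) Ka) → ℝ =>
      (if h : -Kb ≤ n ∧ n ≤ Ka then e i ⟨n, Finset.mem_Icc.mpr h⟩ else 0) := by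
  by_cases h : -Kb ≤ n ∧ n ≤ Ka
  · simp only [h]
    exact (continuous_apply _).comp (continuous_apply i)
  · simp only [h, dif_neg, not_false_eq_true]
    exact continuous_const

/-- **From a Picard path to an exact window trajectory.** Let `ω_k > 0`, `fE` the zero-extension of
window states (`fE e i n = e i ⟨n, _⟩` on the window, `0` off it), `Q` the ω-scaled truncated field,
`T > 0`, and `P : C([0,1], E)` with `P̃' = T • Q(P̃)` within `[0,1]`. Then the unscaled trajectory
`x_{i,n}(s) = ω_n · fE(P̃(s/T))_{i,n}` satisfies, for every window shell `k`, every `0 ≤ S ≤ T` and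
`s ∈ [0, S]`: `HasDerivWithinAt x_{i,k} (quadTerm(x · 𝟙_{window})_{i,k}(s)) [0, S] s`.
[cite: Tao2016AveragedNS, §4 (4.8) (the truncated window system)] -/
theorem flow_hasDerivWithinAt (α : Fin 4 → Fin 4 → Fin 4 → ℤ × ℤ × ℤ → ℝ) {ω : ℤ → ℝ}
    (hω : ∀ k, 0 < ω k)
    (fE : (Fin 4 → ↥(Finset.Icc (-Kb) Ka) → ℝ) → Fin 4 → ℤ → ℝ)
    (hfE1 : ∀ e i n (h : -Kb ≤ n ∧ n ≤ Ka), fE e i n = e i ⟨n, Finset.mem_Icc.mpr h⟩)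
    (hfE0 : ∀ e i n, ¬ (-Kb ≤ n ∧ n ≤ Ka) → fE e i n = 0)
    (Q : (Fin 4 → ↥(Finset.Icc (-Kb) Ka) → ℝ) → (Fin 4 → ↥(Finset.Icc (-Kb) Ka) → ℝ))
    (hQ : ∀ e i (k : ↥(Finset.Icc (-Kb) Ka)),
      Q e i k = quadTerm 1 α (fun j' n (_ : ℝ) => ω n * fE e j' n) i k 0 / ω k)
    {P : C(↥(Icc (0 : ℝ) 1), Fin 4 → ↥(Finset.Icc (-Kb) Ka) → ℝ)} {T : ℝ} (hT : 0 < T)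
    (hP : ∀ t ∈ Icc (0 : ℝ) 1, HasDerivWithinAt (IccExtend zero_le_one P)
      (T • Q (IccExtend zero_le_one P t)) (Icc 0 1) t)
    (x : Fin 4 → ℤ → ℝ → ℝ) (hx : ∀ i n s, x i n s = ω n * fE (IccExtend zero_le_one P (s / T)) i n)
    {S : ℝ} (hS : S ≤ T) :
    ∀ i k, -Kb ≤ k → k ≤ Ka → ∀ s ∈ Icc 0 S, HasDerivWithinAt (x i k)
      (quadTerm 1 α (fun j' n s' => if -Kb ≤ n ∧ n ≤ Ka then x j' n s' else 0) i k s) (Icc 0 S) s := by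
  intro i k hk1 hk2 s hs
  set φ : ℝ → (Fin 4 → ↥(Finset.Icc (-Kb) Ka) → ℝ) := IccExtend zero_le_one P with hφ
  set kk : ↥(Finset.Icc (-Kb) Ka) := ⟨k, Finset.mem_Icc.mpr ⟨hk1, hk2⟩⟩ with hkk
  have hsT : s / T ∈ Icc (0 : ℝ) 1 :=
    ⟨div_nonneg hs.1 hT.le, (div_le_one hT).mpr (hs.2.trans hS)⟩
  -- the component (i, k) of the path
  have h1 : HasDerivWithinAt (fun t => φ t i kk) ((T • Q (φ (s / T))) i kk) (Icc 0 1) (s / T) := by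
    have h0 := hP (s / T) hsT
    have hi := (hasDerivWithinAt_pi.mp h0) i
    exact (hasDerivWithinAt_pi.mp hi) kk
  -- the time rescaling s ↦ s / T
  have h2 : HasDerivWithinAt (fun s' : ℝ => s' / T) (1 / T) (Icc 0 S) s := by
    have := (hasDerivWithinAt_id s (Icc 0 S)).div_const T
    simpa using this
  have hmaps : MapsTo (fun s' : ℝ => s' / T) (Icc 0 S) (Icc 0 1) := fun s' hs' =>
    ⟨div_nonneg hs'.1 hT.le, (div_le_one hT).mpr (hs'.2.trans hS)⟩
  have h3 := h1.scomp s h2 hmaps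
  -- simplify the derivative value and multiply by ω k
  have hval : (1 / T) • (T • Q (φ (s / T))) i kk = Q (φ (s / T)) i kk := by
    simp only [Pi.smul_apply, smul_eq_mul]
    field_simp
  rw [hval] at h3
  have h4 := h3.const_mul (ω k)
  -- identify the function
  have hfun : x i k = fun s' => ω k * ((fun t => φ t i kk) ∘ fun s' : ℝ => s' / T) s' := by
    funext s'
    rw [hx i k s', Function.comp_apply, hfE1 _ i k ⟨hk1, hk2⟩]
  rw [hfun]
  -- identify the derivative value
  have hder : ω k * Q (φ (s / T)) i kk =
      quadTerm 1 α (fun j' n s' => if -Kb ≤ n ∧ n ≤ Ka then x j' n s' else 0) i k s := by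
    rw [hQ, mul_div_cancel₀ _ (hω k).ne']
    refine quadTerm_congr α (fun j n => ?_) i k
    by_cases hn : -Kb ≤ n ∧ n ≤ Ka
    · rw [if_pos hn, hx]
    · rw [if_neg hn, hfE0 _ j n hn, mul_zero]
  rw [← hder]
  exact h4

/-- The unscaled trajectory starts at the unscaled start state: if `P̃(0) = z` then
`x_{i,n}(0) = ω_n · fE(z)_{i,n}`. [folklore] -/
theorem flow_zero {ω : ℤ → ℝ} (fE : (Fin 4 → ↥(Finset.Icc (-Kb) Ka) → ℝ) → Fin 4 → ℤ → ℝ)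
    {P : C(↥(Icc (0 : ℝ) 1), Fin 4 → ↥(Finset.Icc (-Kb) Ka) → ℝ)} {T : ℝ}
    {z : Fin 4 → ↥(Finset.Icc (-Kb) Ka) → ℝ} (hP0 : IccExtend zero_le_one P 0 = z)
    (x : Fin 4 → ℤ → ℝ → ℝ) (hx : ∀ i n s, x i n s = ω n * fE (IccExtend zero_le_one P (s / T)) i n)
    (i : Fin 4) (n : ℤ) : x i n 0 = ω n * fE z i n := by
  rw [hx, zero_div, hP0]

/-- **Componentwise closeness from sup-norm closeness.** For window states `e, e'` and a window shell
`n`: `|fE(e)_{i,n} − fE(e')_{i,n}| ≤ ‖e − e'‖` (and `= 0` off the window). [folklore] -/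
theorem abs_fE_sub_fE_le (fE : (Fin 4 → ↥(Finset.Icc (-Kb) Ka) → ℝ) → Fin 4 → ℤ → ℝ)
    (hfE1 : ∀ e i n (h : -Kb ≤ n ∧ n ≤ Ka), fE e i n = e i ⟨n, Finset.mem_Icc.mpr h⟩)
    (hfE0 : ∀ e i n, ¬ (-Kb ≤ n ∧ n ≤ Ka) → fE e i n = 0)
    (e e' : Fin 4 → ↥(Finset.Icc (-Kb) Ka) → ℝ) (i : Fin 4) (n : ℤ) :
    |fE e i n - fE e' i n| ≤ ‖e - e'‖ := by
  by_cases h : -Kb ≤ n ∧ n ≤ Ka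
  · rw [hfE1 e i n h, hfE1 e' i n h]
    have h1 : |e i ⟨n, Finset.mem_Icc.mpr h⟩ - e' i ⟨n, Finset.mem_Icc.mpr h⟩| =
        ‖(e - e') i ⟨n, Finset.mem_Icc.mpr h⟩‖ := by
      rw [Real.norm_eq_abs]; rfl
    rw [h1]
    exact (norm_le_pi_norm _ _).trans (norm_le_pi_norm _ _)
  · rw [hfE0 e i n h, hfE0 e' i n h, sub_zero, abs_zero]
    exact norm_nonneg _

/-- Componentwise size from the sup norm: `|fE(e)_{i,n}| ≤ ‖e‖`. [folklore] -/
theorem abs_fE_le (fE : (Fin 4 → ↥(Finset.Icc (-Kb) Ka) → ℝ) → Fin 4 → ℤ → ℝ)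
    (hfE1 : ∀ e i n (h : -Kb ≤ n ∧ n ≤ Ka), fE e i n = e i ⟨n, Finset.mem_Icc.mpr h⟩)
    (hfE0 : ∀ e i n, ¬ (-Kb ≤ n ∧ n ≤ Ka) → fE e i n = 0)
    (e : Fin 4 → ↥(Finset.Icc (-Kb) Ka) → ℝ) (i : Fin 4) (n : ℤ) :
    |fE e i n| ≤ ‖e‖ := by
  by_cases h : -Kb ≤ n ∧ n ≤ Ka
  · rw [hfE1 e i n h]
    have h1 : |e i ⟨n, Finset.mem_Icc.mpr h⟩| = ‖e i ⟨n, Finset.mem_Icc.mpr h⟩‖ := (Real.norm_eq_abs _).symm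
    rw [h1]
    exact (norm_le_pi_norm _ _).trans (norm_le_pi_norm _ _)
  · rw [hfE0 e i n h, abs_zero]
    exact norm_nonneg _

end RadiiGlueR

end Summit.NavierStokesRegularity.NavierStokesRegularity.Theorems

end
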